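import Literature.IUT.HodgeTheaters.KitS5LocalOfDatumNonVacuity
import Literature.IUT.HodgeTheaters.PiAvatarKitCoreThetaGluingTransport
import Literature.IUT.HodgeTheaters.PiAvatarKitCoreThetaOfBadPairsGluing
import HarnessLib

/-!
# [IUTchI] Def 5.2 (i) / Def 5.5 (iii) / Rmk 6.12.2 / Def 6.13 AT THE GENUINE Θ-NF DATA: the §5-R4 stub `S5Local` and its
# ℱ-level core agreement `FKitCore` are INHABITED over `baseThetaDatumThetaStandIn ES` and `baseThetaDatumThetaOfBadPairs B ΛBad ES`,
# so the Definition-5.5 ΘNF-side kit `S5Local.ofDatum` EXISTS there and the gluing laws F-2736 / F-2682 / F-2049 FIRE on an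
# actual kit (KIT-RULE non-vacuity; cell abc-iut, seat abc-iut-w4-d054 gen 12, row «FKITCORE-NV-AT-THETASTANDIN»)

S. Mochizuki, *Inter-universal Teichmüller theory I*, kurims manuscript (May 2020): Def 5.2 (i) p. 134 (`ℱ`-prime-strips: data
`‡ℱ_v` consisting of «a category ‡𝒞_v which admits an equivalence of categories ‡𝒞_v ⥲ 𝒞_v» for `v ∈ 𝕍^non`, resp. «such that there
exists an isomorphism of collections of data ‡ℱ_v ⥲ ℱ_v» for `v ∈ 𝕍^arc` — in this file's gloss: arbitrary isomorphs of the models),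
Def 5.5 (iii) p. 153 (ΘNF-Hodge theaters), Ex 5.4 (iii) pp. 147–148 (δ-valuations), Cor 5.6 (i) p. 153,
Rmk 6.12.2 (i)(ii) p. 174 («glued … via the functorial algorithm of Proposition 6.7»; «the gluing isomorphism … is unique»),
Def 6.13 (i) p. 182 / (ii) p. 183 («(c) the [necessarily unique!] gluing isomorphism»), Def 3.1 (b)(c) pp. 61–62
([IUTchI] Def 5.2 (i) p.134) [claim: Mochizuki2012, status: disputed] (D-0012 claim key, series status DISPUTED — CONSISTENCY
WITNESSES for the cell's hypothesis structures over abc-iut-L5-t2's REAL `InitialThetaData`; nothing of the series is asserted,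
no side is taken on [IUTchIII] Cor. 3.12).

## What this file does and why

The gluing-law files at the genuine Θ-NF data — abc-iut-L5-t3's `PiAvatarKitCoreThetaGluing` (p466266), abc-iut-f-193's
`PiAvatarKitCoreThetaGluingTransport` (p492939) and this base's `PiAvatarKitCoreThetaOfBadPairsGluing` (p492055) — quantify
UNIVERSALLY over hypothesis structures: abc-iut-L5-t3's §5-R4 data `S : (baseThetaDatumThetaStandIn ES).S5Local`, an `ℱ`-kit `FK`
and an ℱ-level core agreement `fc : S.FKitCore (kitCoreThetaStandIn ES) FK`, resp. a ΘNF-side kit `N : K.S5Local Mk FK`.  The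
second-read census of p492939 (RQ7-K, 2026-08-27) found NO inhabitant of these structures AT THESE DATA in the tree: the
KIT-RULE inhabitants were abc-iut-w5-d217's `thickFKitCore` over `thickDatum` (`FKitCoreBridgeWitness`) and abc-iut-L5-t5's
GENERIC `BaseThetaDatum.S5Local.ofKitCore K hl5 hba hb N B E hval` / `S5Local.FKitCore.ofKitCore … M` over every converse
datum `ofKitCore` (`KitS5LocalOfDatumNonVacuity`, p442128), instantiated there only at a lifted toy kit.  Both genuine data
ARE converse data — `baseThetaDatumThetaStandIn ES := ofKitCore (baseKitThetaNFStandIn …) … (nfKitThetaStandIn …)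
(MonoBinder.tautological _) (evalBinderThetaNFStandIn … ES)` and likewise `baseThetaDatumThetaOfBadPairs B ΛBad ES`,
definitionally — and abc-iut-L5-t5's one named hypothesis `hval` («automorphisms of `𝒟^⊚` fix the distinguished valuations»)
holds at their NF kits BY `rfl` (abc-iut-L5-t3's `nfKitThetaOfData`: `Val _ := Shrink (Val K)`, `valIso _ := Equiv.refl _`).
Hence, BY NAME and with no new mathematics:

* `s5LocalThetaStandIn ES`, `fKitCoreThetaStandIn ES Mk` (any multiplicative kit `Mk`; in particular `multKitThetaNFStandIn ES`),
  `nonempty_…`, `cor56i_s5LocalThetaStandIn` (Cor 5.6 (i) for the stub, abc-iut-L5-t5's `S5Local.cor56i_ofKitCore`);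
* at universe `Fbar : Type (w+1)` (forced by `S5Local.ofDatum`, as in p492939): `thetaNFKitThetaStandIn ES :=
  S5Local.ofDatum (fKitCoreThetaStandIn ES (multKitThetaNFStandIn ES)) (nfLinkThetaStandIn ES)` — an ACTUAL Definition-5.5
  ΘNF-side kit over the stand-in core — and p492939's / p466266's laws FIRED on it: `gluingTransportLaw_thetaNFKitThetaStandIn`
  (F-2736), `gluingUniqueBad_thetaNFKitThetaStandIn` (F-2682), `gluingUnique_thetaNFKitThetaStandIn` (F-2049),
  `dGluing_subsingleton_…` / `gluing_subsingleton_…` (Def 6.13 (ii)(c) / (i)(c)), packaged binder-free beyond the kit's displayed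
  binders as `exists_thetaNFKit_gluingLaws_thetaStandIn`;
* the same at the parametric bad-pair datum: `s5LocalThetaOfBadPairs`, `fKitCoreThetaOfBadPairs`, `thetaNFKitThetaOfBadPairs`,
  and p492055's `gluingUnique_thetaOfBadPairs` / `gluingUniqueBad_thetaOfBadPairs` / `dGluing_subsingleton_thetaOfBadPairs` FIRED on
  it (`exists_thetaNFKit_gluingUnique_thetaOfBadPairs`).

DISPLAYED BINDERS, exhaustively: the kit's {`CG`, `hS`, `M : TorsionMonodromy`, `hA`, `hI`} «[`X̲→`-profinite stand-in at `v̲ ∈ V̲^bad`]: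
print's `𝒟_v̲` there is `ℬ^temp(X̳_v̲)⁰`, NOT this kit's `ℬ(Π_{X̲→_v̲})⁰`» ∪ {`ES`} (abc-iut-L5-t3's `EvalSectionBinder` family — a LAW
binder; NV = row «EVALSECT-NV», p487210) ∪, in the last part, {`B`, `ΛBad`} (bad-pair DATA with LAWS).  HONEST LABELS carried from
p442128: the stub takes `ℱ_v`-data := the isomorphs of `𝒟_v` themselves with identity base and `ℱ^⊚`/`ℱ^⊛` := the NF kit's isomorphs of
`𝒟^⊚` — a CONSISTENCY DEVICE showing the binder set jointly satisfiable, NOT print's Frobenioid-theoretic `ℱ`-data («KIT-RULE stub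
`ℱ := 𝒟` — NO token for IUTchI:Cor5.6(i)»: `cor56i_s5LocalThetaStandIn` / `cor56i_s5LocalThetaOfBadPairs` are kernel instances of the
junction at OUR stub, never evidence for the node); `hval` is true for the tree's degenerate NF kits (constant valuation sets) and is not
a statement of print (there `Aut(C_K)` moves `𝕍(K)`).  Defs = thin
instantiations by name; every `theorem` is a one-line application of landed theorems; no instance, no notation, no new `Prop` fact.
Typed ≠ inhabited ≠ proved; an inhabitant at OUR stand-in data is not print's universal claim; nothing here asserts that abc is proved or
refuted.
-/

noncomputable section

namespace Literature.IUT.HodgeTheaters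

open CategoryTheory

universe u v w

/-! ### §1. The stand-in datum `baseThetaDatumThetaStandIn ES` (any universe): `S5Local`, `FKitCore`, Cor 5.6 (i) -/

section StandIn

variable {F : Type u} {K : Type v} {Fbar : Type w} [Field F] [NumberField F] [Field K] [NumberField K]
  [Algebra F K] [Field Fbar] [Algebra F Fbar] [Algebra K Fbar]
  {E : WeierstrassCurve F} [E.IsElliptic] {l : ℕ} {Pb : BadPlacePredicates K}
  (D : InitialThetaData F K Fbar E l Pb) (CG : D.geom.pe.CuspGalois) (hS : D.CuspClassesNormaliserStable) [Fact l.Prime]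
  (M : D.TorsionMonodromy) (hA : D.geom.pe.ArrowCoveringClaims)
  (hI : ∀ k ∈ D.geom.pe.inertia D.geom.pe.ε1, M.tau (D.geom.embK k) = 0)

namespace InitialThetaData

variable {Gv : D.IndexCopy → Subgroup (Fbar ≃ₐ[F] Fbar)}
  (ES : ∀ v, v ∈ D.indexCopyBad → EvalSectionBinder (D.localDataStandIn CG hS M hA hI v) (Gv v))

/-- **abc-iut-L5-t5's hypothesis `hval` HOLDS at the stand-in NF kit, by `rfl`**: automorphisms of `𝒟^⊚` fix the distinguished
valuations (the NF kit's valuation sets are the constant `Shrink (Val K)` with `valIso := Equiv.refl`).  Honest label: a property of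
OUR degenerate NF kit, not of print's `Aut(C_K) ↷ 𝕍(K)`. ([IUTchI] Ex 5.4 (iii) pp.147-148) [claim: Mochizuki2012, status: disputed] -/
theorem nfKitThetaStandIn_valIso_valOfV
    (b : (D.nfKitThetaStandIn CG hS M hA hI).gnfModel ≅ (D.nfKitThetaStandIn CG hS M hA hI).gnfModel) (x : D.IndexCopy) :
    (D.nfKitThetaStandIn CG hS M hA hI).valIso b ((D.nfKitThetaStandIn CG hS M hA hI).valOfV x) =
      (D.nfKitThetaStandIn CG hS M hA hI).valOfV x :=
  rfl

/-- **abc-iut-L5-t3's §5-R4 data `S5Local` INHABITED over the stand-in datum `baseThetaDatumThetaStandIn ES`** — abc-iut-L5-t5's generic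
stub `S5Local.ofKitCore` (p442128) at the stand-in kits BY NAME (`ℱ_v`-data := isomorphs of `𝒟_v`, identity base; Θ-Hodge theaters := the
core groupoid of families of isomorphs; `hval` by `rfl`).  A consistency device, not print's `ℱ`-data.
([IUTchI] Def 5.2 (i) p.134) [claim: Mochizuki2012, status: disputed] -/
def s5LocalThetaStandIn : (D.baseThetaDatumThetaStandIn CG hS M hA hI ES).S5Local :=
  BaseThetaDatum.S5Local.ofKitCore (D.baseKitThetaNFStandIn CG hS M hA hI) D.five_le_l (D.indexCopy_not_mem_arc_of_mem_bad)
    D.indexCopyBad_nonempty (D.nfKitThetaStandIn CG hS M hA hI) (PMBaseKit.MonoBinder.tautological _)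
    (D.evalBinderThetaNFStandIn CG hS M hA hI D.five_le_l ES) (D.nfKitThetaStandIn_valIso_valOfV CG hS M hA hI)

/-- **abc-iut-L5-t3's ℱ-level core agreement `FKitCore` INHABITED over the FROZEN stand-in core `kitCoreThetaStandIn ES`**, for every
multiplicative kit `Mk` of the stand-in base kit, with abc-iut-w5-d217's `ℱ`-kit `FKit.ofBase _ Mk` — abc-iut-L5-t5's `S5Local.FKitCore.ofKitCore`
BY NAME (comparison functors identities; `kitCoreThetaStandIn ES` IS `KitCore.ofKit …`, definitionally).
([IUTchI] Def 5.2 (i) p.134) [claim: Mochizuki2012, status: disputed] -/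
def fKitCoreThetaStandIn (Mk : (D.baseKitThetaNFStandIn CG hS M hA hI).MultKit) :
    (D.s5LocalThetaStandIn CG hS M hA hI ES).FKitCore (D.kitCoreThetaStandIn CG hS M hA hI ES) (PMBaseKit.FKit.ofBase _ Mk) :=
  BaseThetaDatum.S5Local.FKitCore.ofKitCore (D.baseKitThetaNFStandIn CG hS M hA hI) D.five_le_l
    (D.indexCopy_not_mem_arc_of_mem_bad) D.indexCopyBad_nonempty (D.nfKitThetaStandIn CG hS M hA hI)
    (PMBaseKit.MonoBinder.tautological _) (D.evalBinderThetaNFStandIn CG hS M hA hI D.five_le_l ES)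
    (D.nfKitThetaStandIn_valIso_valOfV CG hS M hA hI) Mk

/-- **NON-VACUITY of `S5Local` at the stand-in datum.** ([IUTchI] Def 5.2 (i) p.134) [claim: Mochizuki2012, status: disputed] -/
theorem nonempty_s5Local_thetaStandIn : Nonempty (D.baseThetaDatumThetaStandIn CG hS M hA hI ES).S5Local :=
  ⟨D.s5LocalThetaStandIn CG hS M hA hI ES⟩

/-- **NON-VACUITY of `FKitCore` over the stand-in core**, for every multiplicative kit `Mk`: the hypothesis structures `S`, `FK`, `fc` of
p466266 / p492939 are jointly inhabited at `baseThetaDatumThetaStandIn ES`. ([IUTchI] Def 5.2 (i) p.134) [claim: Mochizuki2012, status: disputed] -/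
theorem nonempty_fKitCore_thetaStandIn (Mk : (D.baseKitThetaNFStandIn CG hS M hA hI).MultKit) :
    ∃ (S : (D.baseThetaDatumThetaStandIn CG hS M hA hI ES).S5Local) (FK : (D.baseKitThetaNFStandIn CG hS M hA hI).FKit Mk),
      Nonempty (S.FKitCore (D.kitCoreThetaStandIn CG hS M hA hI ES) FK) :=
  ⟨_, _, ⟨D.fKitCoreThetaStandIn CG hS M hA hI ES Mk⟩⟩

/-- **[IUTchI] Cor 5.6 (i) (abc-iut-L5-t3's frozen node statement `S5Local.Cor56i`) HOLDS for the stub over the stand-in datum** —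
abc-iut-L5-t5's `S5Local.cor56i_ofKitCore` (abc-iut-w5-d217's junction fed with `FKit.ofBase`) BY NAME; a kernel instance of the junction
at OUR stub, not a claim about print's `ℱ`-prime-strips. ([IUTchI] Cor 5.6 (i) p.153) [claim: Mochizuki2012, status: disputed] -/
theorem cor56i_s5LocalThetaStandIn (Mk : (D.baseKitThetaNFStandIn CG hS M hA hI).MultKit) :
    BaseThetaDatum.S5Local.Cor56i (D.s5LocalThetaStandIn CG hS M hA hI ES) :=
  BaseThetaDatum.S5Local.cor56i_ofKitCore (D.baseKitThetaNFStandIn CG hS M hA hI) D.five_le_l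
    (D.indexCopy_not_mem_arc_of_mem_bad) D.indexCopyBad_nonempty (D.nfKitThetaStandIn CG hS M hA hI)
    (PMBaseKit.MonoBinder.tautological _) (D.evalBinderThetaNFStandIn CG hS M hA hI D.five_le_l ES)
    (D.nfKitThetaStandIn_valIso_valOfV CG hS M hA hI) Mk

end InitialThetaData

end StandIn

/-! ### §2. The stand-in datum at universe `Fbar : Type (w+1)`: the Definition-5.5 ΘNF-side kit EXISTS and the gluing laws FIRE on it -/

section StandInFired

variable {F : Type u} {K : Type v} {Fbar : Type (w + 1)} [Field F] [NumberField F] [Field K] [NumberField K]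
  [Algebra F K] [Field Fbar] [Algebra F Fbar] [Algebra K Fbar]
  {E : WeierstrassCurve F} [E.IsElliptic] {l : ℕ} {Pb : BadPlacePredicates K}
  (D : InitialThetaData F K Fbar E l Pb) (CG : D.geom.pe.CuspGalois) (hS : D.CuspClassesNormaliserStable) [Fact l.Prime]
  (M : D.TorsionMonodromy) (hA : D.geom.pe.ArrowCoveringClaims)
  (hI : ∀ k ∈ D.geom.pe.inertia D.geom.pe.ε1, M.tau (D.geom.embK k) = 0)

namespace InitialThetaData

variable {Gv : D.IndexCopy → Subgroup (Fbar ≃ₐ[F] Fbar)}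
  (ES : ∀ v, v ∈ D.indexCopyBad → EvalSectionBinder (D.localDataStandIn CG hS M hA hI v) (Gv v))

/-- **AN ACTUAL Definition-5.5 ΘNF-side kit over the stand-in core**: abc-iut-L5-t3's `S5Local.ofDatum` at the inhabitant
`fKitCoreThetaStandIn ES (multKitThetaNFStandIn ES)` and the `φ^NF` dictionary `nfLinkThetaStandIn ES` — the `N`/`S5Local.ofDatum fc nl` over
which p466266 / p492939 quantify, now a closed term of the REAL initial Θ-data's stand-in kit (modulo the displayed binders).
([IUTchI] Def 5.5 (iii) p.153) [claim: Mochizuki2012, status: disputed] -/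
def thetaNFKitThetaStandIn :
    (D.baseKitThetaNFStandIn CG hS M hA hI).S5Local (D.multKitThetaNFStandIn CG hS M hA hI ES)
      (PMBaseKit.FKit.ofBase _ (D.multKitThetaNFStandIn CG hS M hA hI ES)) :=
  BaseThetaDatum.S5Local.ofDatum (D.fKitCoreThetaStandIn CG hS M hA hI ES (D.multKitThetaNFStandIn CG hS M hA hI ES))
    (D.nfLinkThetaStandIn CG hS M hA hI ES)

/-- **F-2736 `GluingTransportLaw` FIRES on the actual kit** ([IUTchI] Rmk 6.12.2 (i) / Def 4.6 (iii) / Def 6.13 (i)): abc-iut-f-193's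
`gluingTransportLaw_ofDatum_thetaStandIn` (p492939) with its binders `S`, `FK`, `fc` SUPPLIED by §1.
([IUTchI] Rmk 6.12.2 (i) p.174) [claim: Mochizuki2012, status: disputed] -/
theorem gluingTransportLaw_thetaNFKitThetaStandIn :
    (D.thetaNFKitThetaStandIn CG hS M hA hI ES).GluingTransportLaw D.odd_l :=
  D.gluingTransportLaw_ofDatum_thetaStandIn CG hS M hA hI ES _

/-- **F-2682 `GluingUniqueBad` FIRES on the actual kit** ([IUTchI] Rmk 6.12.2 (ii), guarded form): the second component of abc-iut-f-193's
`gluingTransportLaw_and_gluingUniqueBad_ofDatum_thetaStandIn` with `S`, `FK`, `fc` supplied.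
([IUTchI] Rmk 6.12.2 (ii) p.174) [claim: Mochizuki2012, status: disputed] -/
theorem gluingUniqueBad_thetaNFKitThetaStandIn :
    (D.thetaNFKitThetaStandIn CG hS M hA hI ES).GluingUniqueBad D.odd_l :=
  (D.gluingTransportLaw_and_gluingUniqueBad_ofDatum_thetaStandIn CG hS M hA hI ES _).2

/-- **F-2049 `GluingUnique` FIRES on the actual kit** ([IUTchI] Rmk 6.12.2 (ii) / Def 6.13 (i)(c)): abc-iut-f-193's
`gluingUnique_ofDatum_thetaStandIn` with `S`, `FK`, `fc` supplied (bad place from Def 3.1 (b)).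
([IUTchI] Def 6.13 (i) p.182) [claim: Mochizuki2012, status: disputed] -/
theorem gluingUnique_thetaNFKitThetaStandIn :
    (D.thetaNFKitThetaStandIn CG hS M hA hI ES).GluingUnique D.odd_l :=
  D.gluingUnique_ofDatum_thetaStandIn CG hS M hA hI ES _

/-- **[IUTchI] Def 6.13 (ii)(c) on the actual kit**: the `𝒟`-level gluing of the `𝒟`-ΘNF-Hodge theater of a Definition 5.5 (iii)
ΘNF-Hodge theater `H` of the stub to any `𝒟-Θ^±`-bridge is UNIQUE (`Subsingleton`) — p492939's `dGluing_subsingleton_ofDatum_thetaStandIn`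
with `S`, `FK`, `fc` supplied. ([IUTchI] Def 6.13 (ii) p.183) [claim: Mochizuki2012, status: disputed] -/
theorem dGluing_subsingleton_thetaNFKitThetaStandIn (Bpm : (D.baseKitThetaNFStandIn CG hS M hA hI).DThetaPMBridge)
    (H : (D.s5LocalThetaStandIn CG hS M hA hI ES).ThetaNFHodgeTheater) :
    Subsingleton ((D.thetaNFKitThetaStandIn CG hS M hA hI ES).DThetaGluing Bpm
      (BaseThetaDatum.S5Local.dnfhtOf (D.fKitCoreThetaStandIn CG hS M hA hI ES (D.multKitThetaNFStandIn CG hS M hA hI ES))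
        (D.nfLinkThetaStandIn CG hS M hA hI ES) H) D.odd_l) :=
  D.dGluing_subsingleton_ofDatum_thetaStandIn CG hS M hA hI ES _ Bpm H

/-- **[IUTchI] Rmk 6.12.2 (ii) / Def 6.13 (i)(c), ℱ-level, on the actual kit**: the gluing of a Definition 5.5 (iii) ΘNF-Hodge theater `H`
of the stub to a `Θ^±`-bridge `Bth` of the `ℱ`-kit `FKit.ofBase` is UNIQUE — p492939's `gluing_subsingleton_ofDatum_thetaStandIn` with
`S`, `FK`, `fc` supplied. ([IUTchI] Def 6.13 (i) p.182) [claim: Mochizuki2012, status: disputed] -/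
theorem gluing_subsingleton_thetaNFKitThetaStandIn
    (Bth : (PMBaseKit.FKit.ofBase (D.baseKitThetaNFStandIn CG hS M hA hI) (D.multKitThetaNFStandIn CG hS M hA hI ES)).ThetaPMBridge)
    (H : (D.s5LocalThetaStandIn CG hS M hA hI ES).ThetaNFHodgeTheater) :
    Subsingleton ((D.thetaNFKitThetaStandIn CG hS M hA hI ES).ThetaGluing Bth H D.odd_l) :=
  D.gluing_subsingleton_ofDatum_thetaStandIn CG hS M hA hI ES _ Bth H

/-- **Existential packaging (binder-free beyond {CG, hS, M, hA, hI} ∪ {ES})**: over the stand-in base kit and the multiplicative kit generated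
by the evaluation sections there EXIST an `ℱ`-kit and a ΘNF-side kit on which `GluingTransportLaw` (F-2736), `GluingUniqueBad` (F-2682) and
`GluingUnique` (F-2049) all hold — the universally quantified laws of p466266 / p492939 have a NON-VACUOUS instance at the genuine stand-in
datum. ([IUTchI] Rmk 6.12.2 (i) p.174) [claim: Mochizuki2012, status: disputed] -/
theorem exists_thetaNFKit_gluingLaws_thetaStandIn :
    ∃ (FK : (D.baseKitThetaNFStandIn CG hS M hA hI).FKit (D.multKitThetaNFStandIn CG hS M hA hI ES))
      (N : (D.baseKitThetaNFStandIn CG hS M hA hI).S5Local (D.multKitThetaNFStandIn CG hS M hA hI ES) FK),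
      N.GluingTransportLaw D.odd_l ∧ N.GluingUniqueBad D.odd_l ∧ N.GluingUnique D.odd_l :=
  ⟨_, D.thetaNFKitThetaStandIn CG hS M hA hI ES, D.gluingTransportLaw_thetaNFKitThetaStandIn CG hS M hA hI ES,
    D.gluingUniqueBad_thetaNFKitThetaStandIn CG hS M hA hI ES, D.gluingUnique_thetaNFKitThetaStandIn CG hS M hA hI ES⟩

end InitialThetaData

end StandInFired

/-! ### §3. The parametric bad-pair datum `baseThetaDatumThetaOfBadPairs B ΛBad ES` (any universe): `S5Local`, `FKitCore`, Cor 5.6 (i) -/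

section OfBadPairs

variable {F : Type u} {K : Type v} {Fbar : Type w} [Field F] [NumberField F] [Field K] [NumberField K]
  [Algebra F K] [Field Fbar] [Algebra F Fbar] [Algebra K Fbar]
  {E : WeierstrassCurve F} [E.IsElliptic] {l : ℕ} {Pb : BadPlacePredicates K}
  (D : InitialThetaData F K Fbar E l Pb) (CG : D.geom.pe.CuspGalois) (hS : D.CuspClassesNormaliserStable) [Fact l.Prime]
  (M : D.TorsionMonodromy) (hA : D.geom.pe.ArrowCoveringClaims)
  (hI : ∀ k ∈ D.geom.pe.inertia D.geom.pe.ε1, M.tau (D.geom.embK k) = 0)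
  (B : ∀ v, v ∈ D.indexCopyBad → D.BadPairAt v) (ΛBad : ∀ v (h : v ∈ D.indexCopyBad), D.LocalArrowLaw CG hS (B v h).H)

namespace InitialThetaData

variable {Gv : D.IndexCopy → Subgroup (Fbar ≃ₐ[F] Fbar)}
  (ES : ∀ v, v ∈ D.indexCopyBad → EvalSectionBinder (D.localDataOfBadPairs CG hS M hA hI B ΛBad v) (Gv v))

/-- **`hval` HOLDS at the NF kit of the genuine-shape Θ-NF kit with parametric bad-pair data, by `rfl`** (constant valuation sets,
`valIso := Equiv.refl`; a property of OUR degenerate NF kit, not of print). ([IUTchI] Ex 5.4 (iii) pp.147-148) [claim: Mochizuki2012, status: disputed] -/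
theorem nfKitThetaOfBadPairs_valIso_valOfV
    (b : (D.nfKitThetaOfBadPairs CG hS M hA hI B ΛBad).gnfModel ≅ (D.nfKitThetaOfBadPairs CG hS M hA hI B ΛBad).gnfModel)
    (x : D.IndexCopy) :
    (D.nfKitThetaOfBadPairs CG hS M hA hI B ΛBad).valIso b ((D.nfKitThetaOfBadPairs CG hS M hA hI B ΛBad).valOfV x) =
      (D.nfKitThetaOfBadPairs CG hS M hA hI B ΛBad).valOfV x :=
  rfl

/-- **`S5Local` INHABITED over the parametric bad-pair datum `baseThetaDatumThetaOfBadPairs B ΛBad ES`** — abc-iut-L5-t5's `S5Local.ofKitCore`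
BY NAME at abc-iut-w5-d129's kits (p491670); a consistency device, not print's `ℱ`-data. ([IUTchI] Def 5.2 (i) p.134)
[claim: Mochizuki2012, status: disputed] -/
def s5LocalThetaOfBadPairs : (D.baseThetaDatumThetaOfBadPairs CG hS M hA hI B ΛBad ES).S5Local :=
  BaseThetaDatum.S5Local.ofKitCore (D.baseKitThetaNFOfBadPairs CG hS M hA hI B ΛBad) D.five_le_l
    (D.indexCopy_not_mem_arc_of_mem_bad) D.indexCopyBad_nonempty (D.nfKitThetaOfBadPairs CG hS M hA hI B ΛBad)
    (PMBaseKit.MonoBinder.tautological _) (D.evalBinderThetaNFOfBadPairs CG hS M hA hI B ΛBad D.five_le_l ES)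
    (D.nfKitThetaOfBadPairs_valIso_valOfV CG hS M hA hI B ΛBad)

/-- **`FKitCore` INHABITED over abc-iut-w5-d129's FROZEN core `kitCoreThetaOfBadPairs B ΛBad ES`**, for every multiplicative kit `Mk`, with
`FKit.ofBase _ Mk` — abc-iut-L5-t5's `S5Local.FKitCore.ofKitCore` BY NAME. ([IUTchI] Def 5.2 (i) p.134) [claim: Mochizuki2012, status: disputed] -/
def fKitCoreThetaOfBadPairs (Mk : (D.baseKitThetaNFOfBadPairs CG hS M hA hI B ΛBad).MultKit) :
    (D.s5LocalThetaOfBadPairs CG hS M hA hI B ΛBad ES).FKitCore (D.kitCoreThetaOfBadPairs CG hS M hA hI B ΛBad ES)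
      (PMBaseKit.FKit.ofBase _ Mk) :=
  BaseThetaDatum.S5Local.FKitCore.ofKitCore (D.baseKitThetaNFOfBadPairs CG hS M hA hI B ΛBad) D.five_le_l
    (D.indexCopy_not_mem_arc_of_mem_bad) D.indexCopyBad_nonempty (D.nfKitThetaOfBadPairs CG hS M hA hI B ΛBad)
    (PMBaseKit.MonoBinder.tautological _) (D.evalBinderThetaNFOfBadPairs CG hS M hA hI B ΛBad D.five_le_l ES)
    (D.nfKitThetaOfBadPairs_valIso_valOfV CG hS M hA hI B ΛBad) Mk

/-- **NON-VACUITY of `S5Local` ∧ `FKitCore` over the parametric bad-pair core**, for every multiplicative kit `Mk`.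
([IUTchI] Def 5.2 (i) p.134) [claim: Mochizuki2012, status: disputed] -/
theorem nonempty_fKitCore_thetaOfBadPairs (Mk : (D.baseKitThetaNFOfBadPairs CG hS M hA hI B ΛBad).MultKit) :
    ∃ (S : (D.baseThetaDatumThetaOfBadPairs CG hS M hA hI B ΛBad ES).S5Local)
      (FK : (D.baseKitThetaNFOfBadPairs CG hS M hA hI B ΛBad).FKit Mk),
      Nonempty (S.FKitCore (D.kitCoreThetaOfBadPairs CG hS M hA hI B ΛBad ES) FK) :=
  ⟨_, _, ⟨D.fKitCoreThetaOfBadPairs CG hS M hA hI B ΛBad ES Mk⟩⟩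

/-- **[IUTchI] Cor 5.6 (i) HOLDS for the stub over the parametric bad-pair datum** (abc-iut-L5-t5's `S5Local.cor56i_ofKitCore` BY NAME;
a kernel instance of the junction at OUR stub). ([IUTchI] Cor 5.6 (i) p.153) [claim: Mochizuki2012, status: disputed] -/
theorem cor56i_s5LocalThetaOfBadPairs (Mk : (D.baseKitThetaNFOfBadPairs CG hS M hA hI B ΛBad).MultKit) :
    BaseThetaDatum.S5Local.Cor56i (D.s5LocalThetaOfBadPairs CG hS M hA hI B ΛBad ES) :=
  BaseThetaDatum.S5Local.cor56i_ofKitCore (D.baseKitThetaNFOfBadPairs CG hS M hA hI B ΛBad) D.five_le_l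
    (D.indexCopy_not_mem_arc_of_mem_bad) D.indexCopyBad_nonempty (D.nfKitThetaOfBadPairs CG hS M hA hI B ΛBad)
    (PMBaseKit.MonoBinder.tautological _) (D.evalBinderThetaNFOfBadPairs CG hS M hA hI B ΛBad D.five_le_l ES)
    (D.nfKitThetaOfBadPairs_valIso_valOfV CG hS M hA hI B ΛBad) Mk

end InitialThetaData

end OfBadPairs

/-! ### §4. The parametric bad-pair datum at universe `Fbar : Type (w+1)`: the ΘNF-side kit EXISTS and p492055's gluing laws FIRE on it -/

section OfBadPairsFired

variable {F : Type u} {K : Type v} {Fbar : Type (w + 1)} [Field F] [NumberField F] [Field K] [NumberField K]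
  [Algebra F K] [Field Fbar] [Algebra F Fbar] [Algebra K Fbar]
  {E : WeierstrassCurve F} [E.IsElliptic] {l : ℕ} {Pb : BadPlacePredicates K}
  (D : InitialThetaData F K Fbar E l Pb) (CG : D.geom.pe.CuspGalois) (hS : D.CuspClassesNormaliserStable) [Fact l.Prime]
  (M : D.TorsionMonodromy) (hA : D.geom.pe.ArrowCoveringClaims)
  (hI : ∀ k ∈ D.geom.pe.inertia D.geom.pe.ε1, M.tau (D.geom.embK k) = 0)
  (B : ∀ v, v ∈ D.indexCopyBad → D.BadPairAt v) (ΛBad : ∀ v (h : v ∈ D.indexCopyBad), D.LocalArrowLaw CG hS (B v h).H)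

namespace InitialThetaData

variable {Gv : D.IndexCopy → Subgroup (Fbar ≃ₐ[F] Fbar)}
  (ES : ∀ v, v ∈ D.indexCopyBad → EvalSectionBinder (D.localDataOfBadPairs CG hS M hA hI B ΛBad v) (Gv v))

/-- **AN ACTUAL Definition-5.5 ΘNF-side kit over abc-iut-w5-d129's parametric bad-pair core**: `S5Local.ofDatum` at the inhabitant
`fKitCoreThetaOfBadPairs … (multKitThetaNFOfBadPairs … ES)` and the dictionary `nfLinkThetaOfBadPairs` — the `N` over which p492055 quantifies.
([IUTchI] Def 5.5 (iii) p.153) [claim: Mochizuki2012, status: disputed] -/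
def thetaNFKitThetaOfBadPairs :
    (D.baseKitThetaNFOfBadPairs CG hS M hA hI B ΛBad).S5Local (D.multKitThetaNFOfBadPairs CG hS M hA hI B ΛBad ES)
      (PMBaseKit.FKit.ofBase _ (D.multKitThetaNFOfBadPairs CG hS M hA hI B ΛBad ES)) :=
  BaseThetaDatum.S5Local.ofDatum
    (D.fKitCoreThetaOfBadPairs CG hS M hA hI B ΛBad ES (D.multKitThetaNFOfBadPairs CG hS M hA hI B ΛBad ES))
    (D.nfLinkThetaOfBadPairs CG hS M hA hI B ΛBad ES)

/-- **F-2049 `GluingUnique` FIRES on the actual kit over the parametric bad-pair core** — this base's `gluingUnique_thetaOfBadPairs`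
(p492055) with its binder `N` SUPPLIED. ([IUTchI] Rmk 6.12.2 (ii) p.174) [claim: Mochizuki2012, status: disputed] -/
theorem gluingUnique_thetaNFKitThetaOfBadPairs :
    (D.thetaNFKitThetaOfBadPairs CG hS M hA hI B ΛBad ES).GluingUnique D.odd_l :=
  D.gluingUnique_thetaOfBadPairs CG hS M hA hI B ΛBad ES _

/-- **F-2682 `GluingUniqueBad` FIRES on the actual kit over the parametric bad-pair core** — p492055's `gluingUniqueBad_thetaOfBadPairs`
with `N` supplied. ([IUTchI] Rmk 6.12.2 (ii) p.174) [claim: Mochizuki2012, status: disputed] -/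
theorem gluingUniqueBad_thetaNFKitThetaOfBadPairs :
    (D.thetaNFKitThetaOfBadPairs CG hS M hA hI B ΛBad ES).GluingUniqueBad D.odd_l :=
  D.gluingUniqueBad_thetaOfBadPairs CG hS M hA hI B ΛBad ES _

/-- **[IUTchI] Def 6.13 (ii)(c) on the actual kit over the parametric bad-pair core**: the `𝒟`-level gluing of any `𝒟`-ΘNF-Hodge theater of
the kit to any `𝒟-Θ^±`-bridge is UNIQUE — p492055's `dGluing_subsingleton_thetaOfBadPairs` with `N` supplied.
([IUTchI] Def 6.13 (ii) p.183) [claim: Mochizuki2012, status: disputed] -/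
theorem dGluing_subsingleton_thetaNFKitThetaOfBadPairs
    (Bpm : (D.baseKitThetaNFOfBadPairs CG hS M hA hI B ΛBad).DThetaPMBridge)
    (X : (D.thetaNFKitThetaOfBadPairs CG hS M hA hI B ΛBad ES).DNFHT) :
    Subsingleton ((D.thetaNFKitThetaOfBadPairs CG hS M hA hI B ΛBad ES).DThetaGluing Bpm X D.odd_l) :=
  D.dGluing_subsingleton_thetaOfBadPairs CG hS M hA hI B ΛBad ES _ Bpm X

/-- **Existential packaging (binder-free beyond {CG, hS, M, hA, hI} ∪ {B, ΛBad} ∪ {ES})**: over the genuine-shape Θ-NF kit with parametric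
bad-pair data and the multiplicative kit generated by the evaluation sections there EXIST an `ℱ`-kit and a ΘNF-side kit on which
`GluingUnique` (F-2049) and `GluingUniqueBad` (F-2682) hold — p492055's universally quantified laws have a NON-VACUOUS instance.
([IUTchI] Rmk 6.12.2 (ii) p.174) [claim: Mochizuki2012, status: disputed] -/
theorem exists_thetaNFKit_gluingUnique_thetaOfBadPairs :
    ∃ (FK : (D.baseKitThetaNFOfBadPairs CG hS M hA hI B ΛBad).FKit (D.multKitThetaNFOfBadPairs CG hS M hA hI B ΛBad ES))
      (N : (D.baseKitThetaNFOfBadPairs CG hS M hA hI B ΛBad).S5Local (D.multKitThetaNFOfBadPairs CG hS M hA hI B ΛBad ES) FK),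
      N.GluingUnique D.odd_l ∧ N.GluingUniqueBad D.odd_l :=
  ⟨_, D.thetaNFKitThetaOfBadPairs CG hS M hA hI B ΛBad ES, D.gluingUnique_thetaNFKitThetaOfBadPairs CG hS M hA hI B ΛBad ES,
    D.gluingUniqueBad_thetaNFKitThetaOfBadPairs CG hS M hA hI B ΛBad ES⟩

end InitialThetaData

end OfBadPairsFired

end Literature.IUT.HodgeTheaters

end
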